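import Literature.Computability.QuantumComplexity.SandwichApprox
import Literature.Computability.QuantumComplexity.OAAWord
import Literature.Computability.QuantumComplexity.GadgetAssembly
import Literature.Computability.QuantumComplexity.JonesLocalGateCircuit
import Literature.Computability.Cryptography.QubitRegisterProofs
import HarnessLib

/-!
# Conditioned gates: `1 + Π(A − 1)`, label-controlled gates and placements

Topic `Literature/Computability/QuantumComplexity`; infrastructure for the per-letter words of the
discharge of `ajl_jonesApproxProblem_mem_PromiseBQP`. The controlled local unitaries of the AJL
algorithm (Claim 4.1: apply `τ(σᵢ)` controlled by the Hadamard-test qubit, and — in the circuit with a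
one-hot letter table — by the table bit) are products of gadget targets (`SandwichApprox.ctrlGate`);
this file provides the algebra relating them:

* `condOn S A = 1 + projOn S · (A − 1)` — `A` applied on the labels of `S`, identity elsewhere; for
  matrices commuting with `projOn S`, `condOn` is multiplicative (`condOn_mul`, `condOn_listProd`);
* `condOn_ctrlGate` — conditioning a label-controlled gate folds the condition into its blocks;
  `condOn_diagonal`;
* `placeGate_ctrlGate` — a `ctrlGate` of a small register, placed along `e`, is a `ctrlGate` of the
  big register; `ctrlGate_conjTranspose`, `ctrlGate_mul`;
* support and contraction facts (`preservesSupp_ctrlGate`, `isContraction_ctrlGate`).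

## References

* D. Aharonov, V. Jones, Z. Landau, Algorithmica 55 (2009), Claim 4.1 [AharonovJonesLandau2009].
* M. A. Nielsen, I. L. Chuang, *Quantum Computation and Quantum Information*, CUP 2010, §4.3
  (controlled operations) [NielsenChuang2010].
-/

noncomputable section

namespace Literature.Computability.QuantumComplexity

open _root_.Matrix Finset Cryptography

variable {N : ℕ}

/-! ### `condOn` -/

/-- **`A` on the labels of `S`, the identity elsewhere**: `1 + Π_S (A − 1)` (the label-set generalisation of
the fixed-shape `JonesInBQPProofs.controlledGate U`, control = wire `0`, i.e. `condOn {q | q 0 = true}`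
up to the register split). [cite: NielsenChuang2010, §4.3] -/
def condOn (S : Set (QReg N)) (A : Matrix (QReg N) (QReg N) ℂ) : Matrix (QReg N) (QReg N) ℂ :=
  1 + projOn S * (A - 1)

/-- Entries of `condOn`: row `x ∈ S` of `A`, else of `1`. [folklore] -/
theorem condOn_apply (S : Set (QReg N)) [DecidablePred (· ∈ S)] (A : Matrix (QReg N) (QReg N) ℂ) (x z : QReg N) :
    condOn S A x z = if x ∈ S then A x z else (1 : Matrix (QReg N) (QReg N) ℂ) x z := by
  rw [condOn, Matrix.add_apply, projOn, Matrix.diagonal_mul, Matrix.sub_apply]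
  by_cases hx : x ∈ S <;> simp [hx]

/-- `condOn` of the identity. [folklore] -/
@[simp] theorem condOn_one (S : Set (QReg N)) : condOn S (1 : Matrix (QReg N) (QReg N) ℂ) = 1 := by
  simp [condOn]

/-- **`condOn` is multiplicative on matrices commuting with the projection.** [folklore] -/
theorem condOn_mul (S : Set (QReg N)) {A : Matrix (QReg N) (QReg N) ℂ} (hA : A * projOn S = projOn S * A)
    (B : Matrix (QReg N) (QReg N) ℂ) : condOn S A * condOn S B = condOn S (A * B) := by
  have hP : projOn S * projOn S = projOn S := projOn_mul_projOn S
  have hA' : (A - 1) * projOn S = projOn S * (A - 1) := by rw [Matrix.sub_mul, Matrix.mul_sub, hA, Matrix.one_mul, Matrix.mul_one]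
  simp only [condOn, Matrix.add_mul, Matrix.mul_add, Matrix.one_mul, Matrix.mul_one]
  have e : projOn S * (A - 1) * (projOn S * (B - 1)) = projOn S * ((A - 1) * (B - 1)) := by
    rw [Matrix.mul_assoc, ← Matrix.mul_assoc (A - 1), hA', Matrix.mul_assoc, ← Matrix.mul_assoc (projOn S), hP]
  rw [e, add_assoc, ← Matrix.mul_add, ← Matrix.mul_add]
  congr 2
  noncomm_ring

/-- **`condOn` of a product** (factors commuting with the projection, leftmost first). [folklore] -/
theorem condOn_listProd (S : Set (QReg N)) : ∀ (L : List (Matrix (QReg N) (QReg N) ℂ)),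
    (∀ A ∈ L, A * projOn S = projOn S * A) → (L.map (condOn S)).prod = condOn S L.prod
  | [], _ => by simp
  | A :: L, h => by
    rw [List.map_cons, List.prod_cons, List.prod_cons, condOn_listProd S L (fun B hB => h B (by simp [hB])),
      condOn_mul S (h A (by simp))]

/-- **Conditioning a label-controlled gate** folds the condition into the blocks (membership in `S`
must not depend on the rotated wire). [folklore] -/
theorem condOn_ctrlGate {S : Set (QReg N)} [DecidablePred (· ∈ S)] {t : Fin N} (hS : ∀ x b, Function.update x t b ∈ S ↔ x ∈ S)
    (V : QReg N → Matrix (QReg 1) (QReg 1) ℂ) :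
    condOn S (ctrlGate t V) = ctrlGate t (fun z => if z ∈ S then V z else 1) := by
  ext x z
  rw [condOn_apply, ctrlGate_apply, ctrlGate_apply]
  by_cases hzx : EqOff [t] z x
  · have hzS : z ∈ S ↔ x ∈ S := by rw [eqOff_singleton_iff.1 hzx]; exact hS x (z t)
    simp only [if_pos hzx]
    by_cases hx : x ∈ S
    · rw [if_pos hx, if_pos (hzS.2 hx)]
    · rw [if_neg hx, if_neg (fun h => hx (hzS.1 h)), Matrix.one_apply, Matrix.one_apply]
      by_cases hxz : x = z
      · subst hxz; simp
      · rw [if_neg hxz, if_neg]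
        intro h; apply hxz
        have htt : x t = z t := congrFun h 0
        have := eqOff_singleton_iff.1 hzx
        rw [← htt, Function.update_eq_self] at this
        exact this.symm
  · simp only [if_neg hzx]
    by_cases hx : x ∈ S
    · rw [if_pos hx]
    · rw [if_neg hx, Matrix.one_apply, if_neg]; rintro rfl; exact hzx (eqOff_refl _)

/-- **Conditioning a diagonal matrix.** [folklore] -/
theorem condOn_diagonal (S : Set (QReg N)) [DecidablePred (· ∈ S)] (d : QReg N → ℂ) :
    condOn S (Matrix.diagonal d) = Matrix.diagonal (fun z => if z ∈ S then d z else 1) := by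
  ext x z
  rw [condOn_apply, Matrix.diagonal_apply, Matrix.diagonal_apply, Matrix.one_apply]
  by_cases hx : x ∈ S <;> by_cases hxz : x = z <;> simp [hx, hxz]

/-! ### `ctrlGate`: placement, adjoint, products, support -/

/-- **A label-controlled one-qubit gate of a small register, placed along `e`, is a label-controlled
gate of the big register.** [folklore] -/
theorem placeGate_ctrlGate {k : ℕ} (e : Fin k ↪ Fin N) (j : Fin k) (V : QReg k → Matrix (QReg 1) (QReg 1) ℂ) :
    placeGate e (ctrlGate j V) = ctrlGate (e j) (fun z => V (z ∘ e)) := by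
  ext x z
  rw [placeGate_apply, ctrlGate_apply, ctrlGate_apply]
  by_cases h : EqOff [e j] z x
  · have h1 : ∀ i, i ∉ Set.range e → x i = z i := fun i hi => (h i (by
      rw [List.mem_singleton]; rintro rfl; exact hi ⟨j, rfl⟩)).symm
    have h2 : EqOff [j] (z ∘ e) (x ∘ e) := fun i hi => h (e i) (by
      rw [List.mem_singleton] at hi ⊢; exact fun hh => hi (e.injective hh))
    rw [if_pos h1, if_pos h2, if_pos h]; rfl
  · rw [if_neg h]
    split_ifs with h1 h2
    · exfalso; apply h
      intro i hi
      rw [List.mem_singleton] at hi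
      by_cases hie : i ∈ Set.range e
      · obtain ⟨i', rfl⟩ := hie
        exact h2 i' (by rw [List.mem_singleton]; exact fun hh => hi (congrArg e hh))
      · exact (h1 i hie).symm
    · rfl
    · rfl

/-- **The adjoint of a label-controlled gate** (blocks independent of the rotated bit). [folklore] -/
theorem ctrlGate_conjTranspose (t : Fin N) {V : QReg N → Matrix (QReg 1) (QReg 1) ℂ} (hVt : ∀ z b, V (Function.update z t b) = V z) :
    (ctrlGate t V)ᴴ = ctrlGate t (fun z => (V z)ᴴ) := by
  ext x z
  rw [Matrix.conjTranspose_apply, ctrlGate_apply, ctrlGate_apply]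
  by_cases h : EqOff [t] z x
  · have hV : V x = V z := by rw [eqOff_singleton_iff.1 h, hVt]
    rw [if_pos h, if_pos h.symm, Matrix.conjTranspose_apply, hV]
  · rw [if_neg h, if_neg (fun h' => h h'.symm), star_zero]

/-- **Products of label-controlled gates on the same wire** multiply blockwise (the left factor's
blocks must not depend on the rotated bit). [folklore] -/
theorem ctrlGate_mul (t : Fin N) {V : QReg N → Matrix (QReg 1) (QReg 1) ℂ} (W : QReg N → Matrix (QReg 1) (QReg 1) ℂ)
    (hVt : ∀ z b, V (Function.update z t b) = V z) : ctrlGate t V * ctrlGate t W = ctrlGate t (fun z => V z * W z) := by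
  ext x z
  rw [Matrix.mul_apply, ctrlGate_apply]
  have key : ∀ y, ctrlGate t V x y * ctrlGate t W y z =
      if EqOff [t] z x ∧ (y = Function.update z t (y t)) then V z (fun _ => x t) (fun _ => y t) * W z (fun _ => y t) (fun _ => z t) else 0 := by
    intro y
    rw [ctrlGate_apply, ctrlGate_apply]
    by_cases hyx : EqOff [t] y x
    · by_cases hzy : EqOff [t] z y
      · have hzx : EqOff [t] z x := hzy.trans hyx
        have hy : y = Function.update z t (y t) := by
          rw [eqOff_singleton_iff.1 hyx, eqOff_singleton_iff.1 hzx]; simp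
        rw [if_pos hyx, if_pos hzy, if_pos ⟨hzx, hy⟩, show V y = V z by rw [hy, hVt]]
      · rw [if_neg hzy, mul_zero, if_neg]
        rintro ⟨-, hy⟩; exact hzy (eqOff_singleton_iff.2 (by rw [hy]; simp))
    · rw [if_neg hyx, zero_mul, if_neg]
      rintro ⟨hzx, hy⟩; apply hyx
      rw [hy, eqOff_singleton_iff.1 hzx]; exact eqOff_singleton_iff.2 (by simp)
  simp_rw [key]
  by_cases hzx : EqOff [t] z x
  · simp only [hzx, true_and, if_true]
    have hne : Function.update z t false ≠ Function.update z t true := fun h => by have := congrFun h t; simp at this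
    rw [Fintype.sum_eq_add (Function.update z t false) (Function.update z t true) hne (fun y hy => if_neg fun hyeq => by
      cases hyt : y t
      · exact hy.1 (by rw [hyeq, hyt])
      · exact hy.2 (by rw [hyeq, hyt]))]
    simp only [Function.update_self, if_true]
    rw [Matrix.mul_apply, sum_qReg_one_bool]
  · simp only [hzx, false_and, if_false, Finset.sum_const_zero]

/-- A label-controlled gate changes only its wire: it preserves cleanliness elsewhere. [folklore] -/
theorem preservesSupp_ctrlGate {ws : List (Fin N)} {t : Fin N} (ht : t ∉ ws) (V : QReg N → Matrix (QReg 1) (QReg 1) ℂ) :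
    PreservesSupp (cleanOn ws) (ctrlGate t V) := by
  intro ψ hψ x hx
  rw [Matrix.mulVec, dotProduct]
  refine Finset.sum_eq_zero fun z _ => ?_
  rw [ctrlGate_apply]
  split_ifs with h
  · rw [hψ z (fun hz => hx ?_), mul_zero]
    rw [← update_mem_cleanOn_iff ht x (z t), ← eqOff_singleton_iff.1 h]; exact hz
  · exact zero_mul _

/-- A label-controlled gate with unitary blocks (independent of the rotated bit) is a contraction.
[folklore] -/
theorem isContraction_ctrlGate (t : Fin N) {V : QReg N → Matrix (QReg 1) (QReg 1) ℂ}
    (hV : ∀ z, V z ∈ Matrix.unitaryGroup (QReg 1) ℂ) (hVt : ∀ z b, V (Function.update z t b) = V z) :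
    IsContraction (ctrlGate t V) :=
  isContraction_of_mem_unitaryGroup (ctrlGate_mem_unitaryGroup t hV hVt)

end Literature.Computability.QuantumComplexity

end
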